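import Summits.BirchSwinnertonDyer.BirchSwinnertonDyer.Theorems.EisensteinPrimesMazurMCOnCellBTwistbackSubrowCell5568g1
import Summits.BirchSwinnertonDyer.BirchSwinnertonDyer.Theorems.EisensteinPrimesMazurMCOnCellBTwistbackSubrowKernelDiscNegTwo
import HarnessLib

/-!
# Crux 3 `MazurMCOnCellB` (stmt-BirchSwinnertonDyer-19033), line `twistback` v5/v6 — the SKELETON'S sub-row datum
# (the existential excluded by the registered stub `stub_upperPartnerOffSubrow`, consumed by `upperPartner_onSubrow`)
# from kernel-discriminant data, and the first census cell ON THE CLOSED SUB-ROW IN THE KERNEL, UNCONDITIONALLY: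
# `(5568g1, 3)` (part 7 of `…LocalBalanceAtUnramifiedPlace`)

Width seat bsd-line-x2-p1-w7 (gen 2), cell `bsd-eis` (run/shared/lean/pub/bsd-eis/), 2026-08-28. HONEST FRAMING: §1–§2 are
UNCONDITIONAL kernel theorems (Dirichlet-character / Galois-module algebra over tree theorems; no named fact, no reading);
THEOREMS ONLY (no `def`, no named fact introduced, no `sorry`); `--supports`
stmt-BirchSwinnertonDyer-19033; closes no stub; nothing is booked; the pair `(5568g1, 3)` stays OPEN on TARGET (its Mazur
main conjecture needs STEP L = item -27489 / Keller–Yin Thm. D and a Heegner datum downstream); no summit statement, no Mazur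
main conjecture and no BSD is proved for any curve; 0 cells / labels / stubs / tiers move.

WHY. The registered skeleton (v5 355e1eaf… / v6 56f80a58…) splits (∃-PARTNER) by `by_cases` on
«`p = 3 ∧ 3 non-split ∧ ∃ (Φ₀, m, φ, d, ψ, S₀), line datum with local balance 1`»; on that sub-row `upperPartner_onSubrow` is
sorry-free modulo FACT stubs, off it the open stub 6′ applies. Which census cells lie ON the sub-row has so far been a READING
(`c(E) = 1`, CA-g9-1: 30/44 non-split A10 cells). This file makes it a KERNEL STATEMENT per pair:

* §1 `exists_subrowDatum_of_kernelRadical` — from a rational `3`-line `Φ₀`, a quadratic `ℤ`-valued character `χ` mod `N`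
  (`χ̄` primitive) with radical `s` and «`σ` fixes `Φ₀` iff `σ • s = s`», finite `S₀ ⊇ A` (`3 ∉ S₀`, `W` good off
  `S₀ ∪ {3}`, `A` additive, `S₀ ∖ A` multiplicative) and the decidable identity
  `1 = Σ_{S₀∖A} s_ℓ[split] + Σ_{A}(0 if ℓ ∣ N | s_ℓ if ℓ % 3 = 2 | 2s_ℓ[χ(ℓ) = 1])`: THE SKELETON'S EXISTENTIAL, token for
  token (`φ = χ̄` by `X3Branch.smul_eq_quadraticCharacter_of_kernel_sqrt`, `ψ` by `ResidualLineCharacters.exists_character_quot`,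
  the raw balance by part 3's `balance_iff_lineChar_at_three`); `exists_subrowDatum_of_kernelDisc_two_mul` — the
  `D = 2n*` wrapper (part 4's radical); the other three types are the same one-liner over parts 3–5's radicals.
* §2 **`subrowDatum_5568g1`** — the existential AT `W = 5568g1`, NO HYPOTHESIS beyond the curve's (kernel-proved)
  ellipticity / minimality: `(5568g1, 3)` is ON the closed sub-row IN THE KERNEL (certificate `(x₀, s, D) = (33, 34992, 2)`,
  `S₀ = {(2), (29)}`, part 6's per-pair clauses).
* Consistency (checked on the farm, not re-landed — it restates part 6's theorem): feeding §2 to w3 g11's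
  `upperPartner_at_three_of_balanceOne_of_padicGZ` (the exact theorem v6's `upperPartner_onSubrow` instantiates) by
  `… (cellB_5568g1_of_analyticRank hr) nonsplit_5568g1.2 subrowDatum_5568g1` elaborates to part 6's
  `upperPartner_5568g1_at_three_of_padicGZ` statement: the per-pair format and the skeleton's sub-row wiring agree.

References: [GreenbergVatsal2000] §2 Prop. (2.4), p. 28, §3 Thm. (3.11) and p. 43; [Washington1997] Ch. 3; [Disegni2020]
§2.2 Thm. 2.4, §3.2 Thm. 4; [NakagawaHorie1988] Thm. 1; [SilvermanAEC2009] VII.5 Prop. 5.1; Cremona `ecdata` (class 5568g).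
-/

set_option autoImplicit false
-- `Summit.BirchSwinnertonDyer.BirchSwinnertonDyer.…`: the summit and its single sub-problem share a name.
set_option linter.dupNamespace false

noncomputable section

open scoped Classical NumberTheorySymbols

open NumberField IsDedekindDomain Field WeierstrassCurve DirichletCharacter
  Literature.NumberTheory.EllipticCurves Literature.NumberTheory.GaloisRepresentations
  Literature.NumberTheory.EllipticCurves.GreenbergVatsal2000
  Literature.NumberTheory.EllipticCurves.Rank1Residual Literature.NumberTheory.EllipticCurves.Rank1Residual.Typed
  Literature.NumberTheory.EllipticCurves.Disegni2020
  Summit.BirchSwinnertonDyer.Rank1Residual Summit.BirchSwinnertonDyer.Rank1Residual.X2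
  Summit.BirchSwinnertonDyer.Rank1Residual.Additive
  Summit.BirchSwinnertonDyer.Rank1Residual.X2.RouteGSplitDisplay5568g1Local
  Summit.BirchSwinnertonDyer.Rank1Residual.X2.RouteGSplitDisplay5568g1
  Summit.BirchSwinnertonDyer.BirchSwinnertonDyer.Theses
  Summit.BirchSwinnertonDyer.BirchSwinnertonDyer.Theorems.EisensteinPrimesLineCharactersUnramifiedAtMultiplicativePlace
  Summit.BirchSwinnertonDyer.BirchSwinnertonDyer.Theorems.EisensteinPrimesMazurMCOnCellBTwistbackDisplay5568g1
  Summit.BirchSwinnertonDyer.BirchSwinnertonDyer.Theorems.EisensteinPrimesMazurMCOnCellBTwistbackSubrowEvaluatedBalance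
  Summit.BirchSwinnertonDyer.BirchSwinnertonDyer.Theorems.EisensteinPrimesMazurMCOnCellBTwistbackSubrowLineCharBalance
  Summit.BirchSwinnertonDyer.BirchSwinnertonDyer.Theorems.EisensteinPrimesMazurMCOnCellBTwistbackSubrowKernelDiscEven
  Summit.BirchSwinnertonDyer.BirchSwinnertonDyer.Theorems.EisensteinPrimesMazurMCOnCellBTwistbackSubrowCell5568g1
  Summit.BirchSwinnertonDyer.BirchSwinnertonDyer.Theorems.EisensteinPrimesMazurMCOnCellBTwistbackSubrowPartnerAnyLinePAdicGZ

namespace Summit.BirchSwinnertonDyer.BirchSwinnertonDyer.Theorems.EisensteinPrimesMazurMCOnCellBTwistbackSubrowDatumOfKernelDisc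

variable {W : WeierstrassCurve ℚ} [W.IsElliptic]

/-! ## §1. The skeleton's sub-row existential from kernel-radical data -/

/-- **The SKELETON's sub-row datum from a kernel radical** (unconditional). Data: a rational `3`-line `Φ₀ ≤ W[3]`; a
quadratic `ℤ`-valued character `χ` modulo `N` with `χ̄ = χ mod 3` PRIMITIVE, a radical `s ≠ 0` with `τ • s = χ(χ_N τ)·s`
and «`σ` fixes `Φ₀` pointwise iff `σ • s = s`»; a finite `S₀` of places with `3 ∉ S₀` off which (and off `3`) `W` has good
reduction, `A ⊆ S₀` additive, `S₀ ∖ A` multiplicative; the identity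
`1 = Σ_{S₀∖A} s_ℓ[split] + Σ_{v∈A}(0 if ℓ ∣ N | s_ℓ if ℓ % 3 = 2 | 2s_ℓ[χ(ℓ) = 1])`. Conclusion: the existential of the
registered stub `stub_upperPartnerOffSubrow`'s excluded sub-row (≡ the hypothesis `hbal` of
`upperPartner_at_three_of_balanceOne_of_{thmE,padicGZ}`), TOKEN FOR TOKEN: the pair lies on the closed sub-row.
[cite: GreenbergVatsal2000, §2 Prop. (2.4), p. 28 and §3 p. 43] [cite: Washington1997, Ch. 3] -/
theorem exists_subrowDatum_of_kernelRadical [W.IsGloballyMinimal]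
    {Φ₀ : AddSubgroup (geomTorsion W (3 : ℤ))} (hΦ : IsRationalLine W 3 Φ₀)
    {N : ℕ} [NeZero N] (χ : MulChar (ZMod N) ℤ) (hχ2 : χ.IsQuadratic)
    (hprim : DirichletCharacter.IsPrimitive
      (χ.ringHomComp (Int.castRingHom (ZMod 3)) : DirichletCharacter (ZMod 3) N))
    {s : AlgebraicClosure ℚ} (hs0 : s ≠ 0)
    (hs : ∀ τ : absoluteGaloisGroup ℚ,
      τ • s = ((χ (modNCyclotomicCharacter ℚ N τ : ZMod N) : ℤ) : AlgebraicClosure ℚ) * s)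
    (hker : ∀ σ : absoluteGaloisGroup ℚ, (∀ Q ∈ Φ₀, σ • Q = Q) ↔ σ • s = s)
    (S₀ : Finset (HeightOneSpectrum (𝓞 ℚ))) (hS₀p : ∀ v ∈ S₀, ((3 : ℕ) : 𝓞 ℚ) ∉ v.asIdeal)
    (hS : ∀ v : HeightOneSpectrum (𝓞 ℚ), v ∉ S₀ → ((3 : ℕ) : 𝓞 ℚ) ∉ v.asIdeal → W.HasGoodReductionAt v)
    (A : Finset (HeightOneSpectrum (𝓞 ℚ))) (hAS : A ⊆ S₀) (hA : ∀ v ∈ A, W.HasAdditiveReductionAt v)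
    (hmult : ∀ v ∈ S₀, v ∉ A → W.HasMultiplicativeReductionAt v)
    (hbal : 1 = ∑ v ∈ S₀ \ A, (if W.HasSplitMultiplicativeReductionAt v
          then sFactor 3 (Rat.HeightOneSpectrum.natGenerator v) else 0) +
      ∑ v ∈ A, (if Rat.HeightOneSpectrum.natGenerator v ∣ N then 0 else
        if Rat.HeightOneSpectrum.natGenerator v % 3 = 2 then sFactor 3 (Rat.HeightOneSpectrum.natGenerator v)
        else 2 * (if χ (Rat.HeightOneSpectrum.natGenerator v : ZMod N) = 1
          then sFactor 3 (Rat.HeightOneSpectrum.natGenerator v) else 0))) :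
    ∃ (Φ₀ : AddSubgroup (geomTorsion W (3 : ℤ))) (m : ℕ) (_ : NeZero m) (φ : DirichletCharacter (ZMod 3) m)
        (d : ℕ) (_ : NeZero d) (ψ : DirichletCharacter (ZMod 3) d) (S₀ : Finset (HeightOneSpectrum (𝓞 ℚ))),
      IsRationalLine W 3 Φ₀ ∧ φ.IsPrimitive ∧ ψ.IsPrimitive ∧
      (∀ (σ : absoluteGaloisGroup ℚ), ∀ P ∈ Φ₀,
        σ • P = (φ ((modNCyclotomicCharacter ℚ m σ : (ZMod m)ˣ) : ZMod m)).val • P) ∧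
      (∀ (σ : absoluteGaloisGroup ℚ) (P : geomTorsion W (3 : ℤ)),
        σ • P - (ψ ((modNCyclotomicCharacter ℚ d σ : (ZMod d)ˣ) : ZMod d)).val • P ∈ Φ₀) ∧
      (∀ v ∈ S₀, ((3 : ℕ) : 𝓞 ℚ) ∉ v.asIdeal) ∧
      (∀ v : HeightOneSpectrum (𝓞 ℚ), v ∉ S₀ → ((3 : ℕ) : 𝓞 ℚ) ∉ v.asIdeal → W.HasGoodReductionAt v) ∧
      1 + ∑ v ∈ S₀, delta W 3 v =
        ∑ v ∈ S₀, ((if φ (Rat.HeightOneSpectrum.natGenerator v : ZMod m) =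
              (Rat.HeightOneSpectrum.natGenerator v : ZMod 3)
            then sFactor 3 (Rat.HeightOneSpectrum.natGenerator v) else 0) +
          (if ψ (Rat.HeightOneSpectrum.natGenerator v : ZMod d) =
              (Rat.HeightOneSpectrum.natGenerator v : ZMod 3)
            then sFactor 3 (Rat.HeightOneSpectrum.natGenerator v) else 0)) := by
  haveI : Fact (Nat.Prime 3) := ⟨Nat.prime_three⟩
  -- the line character `φ = χ̄` and an abstract quotient character `ψ`
  have hφ0 : ∀ (σ : absoluteGaloisGroup ℚ), ∀ P ∈ Φ₀,
      σ • P = ((χ.ringHomComp (Int.castRingHom (ZMod 3)) : DirichletCharacter (ZMod 3) N)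
        ((modNCyclotomicCharacter ℚ N σ : (ZMod N)ˣ) : ZMod N)).val • P :=
    fun σ P hP ↦ X3Branch.smul_eq_quadraticCharacter_of_kernel_sqrt hΦ χ hχ2 hs0 hs hker σ P hP
  obtain ⟨d, hd, ψ, hψ, -, hψ0⟩ := ResidualLineCharacters.exists_character_quot hΦ
  -- the identity in the line character
  have hbalφ : 1 = ∑ v ∈ S₀ \ A, (if W.HasSplitMultiplicativeReductionAt v
          then sFactor 3 (Rat.HeightOneSpectrum.natGenerator v) else 0) +
      ∑ v ∈ A, (if Rat.HeightOneSpectrum.natGenerator v ∣ N then 0 else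
        if Rat.HeightOneSpectrum.natGenerator v % 3 = 2 then sFactor 3 (Rat.HeightOneSpectrum.natGenerator v)
        else 2 * (if (χ.ringHomComp (Int.castRingHom (ZMod 3)) : DirichletCharacter (ZMod 3) N)
            (Rat.HeightOneSpectrum.natGenerator v : ZMod N) = 1
          then sFactor 3 (Rat.HeightOneSpectrum.natGenerator v) else 0)) := by
    rw [hbal]
    congr 1
    refine Finset.sum_congr rfl fun v _ ↦ ?_
    have hiff := EisensteinPrimesMazurMCOnCellBTwistbackSubrowLineCharBalance.ringHomComp_eq_one_iff χ hχ2
      (Rat.HeightOneSpectrum.natGenerator v : ZMod N)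
    by_cases h1 : χ (Rat.HeightOneSpectrum.natGenerator v : ZMod N) = 1
    · rw [if_pos h1, if_pos (hiff.mpr h1)]
    · rw [if_neg h1, if_neg (fun h ↦ h1 (hiff.mp h))]
  exact ⟨Φ₀, N, inferInstance, _, d, hd, ψ, S₀, hΦ, hprim, hψ, hφ0, hψ0, hS₀p, hS,
    (EisensteinPrimesMazurMCOnCellBTwistbackSubrowLineCharBalance.balance_iff_lineChar_at_three hAS hS₀p hA hmult hΦ
      hprim hψ hφ0 hψ0 1).mpr hbalφ⟩

/-- **The skeleton's sub-row datum for kernel discriminant `D = 2n*`** (`n` odd squarefree; `n = 1`: `D = 2`) — §1 over part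
4's radical `exists_quadraticChar_geomSqrt_two_mul_star`: data = `Φ₀`, «`σ` fixes `Φ₀` iff `σ√(2n*) = √(2n*)`», `S₀ ⊇ A`
with reduction types, identity with level `8n` and indicator `[χ₈(ℓ)J(ℓ | n) = 1]`. Unconditional. (The types `n*`, `−n*`,
`−2n*` are the same one-liner over parts 3–5's radicals.) [cite: GreenbergVatsal2000, §2 Prop. (2.4) and §3 p. 43]
[cite: Washington1997, Ch. 2 and Ch. 3] -/
theorem exists_subrowDatum_of_kernelDisc_two_mul [W.IsGloballyMinimal]
    {Φ₀ : AddSubgroup (geomTorsion W (3 : ℤ))} (hΦ : IsRationalLine W 3 Φ₀)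
    {n : ℕ} [NeZero n] (hn : Odd n) (hsq : Squarefree n)
    (hker : ∀ σ : absoluteGaloisGroup ℚ,
      (∀ Q ∈ Φ₀, σ • Q = Q) ↔ σ • geomSqrt ((2 * ((-1 : ℤ) ^ (n / 2) * n) : ℤ) : ℚ) =
        geomSqrt ((2 * ((-1 : ℤ) ^ (n / 2) * n) : ℤ) : ℚ))
    (S₀ : Finset (HeightOneSpectrum (𝓞 ℚ))) (hS₀p : ∀ v ∈ S₀, ((3 : ℕ) : 𝓞 ℚ) ∉ v.asIdeal)
    (hS : ∀ v : HeightOneSpectrum (𝓞 ℚ), v ∉ S₀ → ((3 : ℕ) : 𝓞 ℚ) ∉ v.asIdeal → W.HasGoodReductionAt v)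
    (A : Finset (HeightOneSpectrum (𝓞 ℚ))) (hAS : A ⊆ S₀) (hA : ∀ v ∈ A, W.HasAdditiveReductionAt v)
    (hmult : ∀ v ∈ S₀, v ∉ A → W.HasMultiplicativeReductionAt v)
    (hbal : 1 = ∑ v ∈ S₀ \ A, (if W.HasSplitMultiplicativeReductionAt v
          then sFactor 3 (Rat.HeightOneSpectrum.natGenerator v) else 0) +
      ∑ v ∈ A, (if Rat.HeightOneSpectrum.natGenerator v ∣ 8 * n then 0 else
        if Rat.HeightOneSpectrum.natGenerator v % 3 = 2 then sFactor 3 (Rat.HeightOneSpectrum.natGenerator v)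
        else 2 * (if ZMod.χ₈ (Rat.HeightOneSpectrum.natGenerator v : ZMod 8) *
            J((Rat.HeightOneSpectrum.natGenerator v : ℤ) | n) = 1
          then sFactor 3 (Rat.HeightOneSpectrum.natGenerator v) else 0))) :
    ∃ (Φ₀ : AddSubgroup (geomTorsion W (3 : ℤ))) (m : ℕ) (_ : NeZero m) (φ : DirichletCharacter (ZMod 3) m)
        (d : ℕ) (_ : NeZero d) (ψ : DirichletCharacter (ZMod 3) d) (S₀ : Finset (HeightOneSpectrum (𝓞 ℚ))),
      IsRationalLine W 3 Φ₀ ∧ φ.IsPrimitive ∧ ψ.IsPrimitive ∧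
      (∀ (σ : absoluteGaloisGroup ℚ), ∀ P ∈ Φ₀,
        σ • P = (φ ((modNCyclotomicCharacter ℚ m σ : (ZMod m)ˣ) : ZMod m)).val • P) ∧
      (∀ (σ : absoluteGaloisGroup ℚ) (P : geomTorsion W (3 : ℤ)),
        σ • P - (ψ ((modNCyclotomicCharacter ℚ d σ : (ZMod d)ˣ) : ZMod d)).val • P ∈ Φ₀) ∧
      (∀ v ∈ S₀, ((3 : ℕ) : 𝓞 ℚ) ∉ v.asIdeal) ∧
      (∀ v : HeightOneSpectrum (𝓞 ℚ), v ∉ S₀ → ((3 : ℕ) : 𝓞 ℚ) ∉ v.asIdeal → W.HasGoodReductionAt v) ∧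
      1 + ∑ v ∈ S₀, delta W 3 v =
        ∑ v ∈ S₀, ((if φ (Rat.HeightOneSpectrum.natGenerator v : ZMod m) =
              (Rat.HeightOneSpectrum.natGenerator v : ZMod 3)
            then sFactor 3 (Rat.HeightOneSpectrum.natGenerator v) else 0) +
          (if ψ (Rat.HeightOneSpectrum.natGenerator v : ZMod d) =
              (Rat.HeightOneSpectrum.natGenerator v : ZMod 3)
            then sFactor 3 (Rat.HeightOneSpectrum.natGenerator v) else 0)) := by
  haveI : NeZero (8 * n) := ⟨mul_ne_zero (by norm_num) (NeZero.ne _)⟩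
  obtain ⟨χ, hχ2, hprim, hval, hrad⟩ :=
    EisensteinPrimesMazurMCOnCellBTwistbackSubrowKernelDiscEven.exists_quadraticChar_geomSqrt_two_mul_star hn hsq
  have hD0 : ((2 * ((-1 : ℤ) ^ (n / 2) * n) : ℤ) : ℚ) ≠ 0 := by
    have hn0 : (n : ℤ) ≠ 0 := by exact_mod_cast NeZero.ne n
    have : (2 * ((-1 : ℤ) ^ (n / 2) * n) : ℤ) ≠ 0 :=
      mul_ne_zero two_ne_zero (mul_ne_zero (pow_ne_zero _ (by norm_num)) hn0)
    exact_mod_cast this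
  refine exists_subrowDatum_of_kernelRadical hΦ χ hχ2 hprim (geomSqrt_ne_zero hD0) hrad hker S₀ hS₀p hS A hAS hA
    hmult ?_
  rw [hbal]
  congr 1
  refine Finset.sum_congr rfl fun v _ ↦ ?_
  rw [hval]

/-! ## §2. The census cell `(5568g1, 3)` is ON the closed sub-row, in the kernel -/

/-- Distinct primes give distinct places of `ℚ`. [folklore] -/
private theorem place_ne' {ℓ ℓ' : ℕ} (hℓ : ℓ.Prime) (hℓ' : ℓ'.Prime) (h : ℓ ≠ ℓ') :
    (Rat.HeightOneSpectrum.primesEquiv (R := 𝓞 ℚ)).symm ⟨ℓ, hℓ⟩ ≠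
      (Rat.HeightOneSpectrum.primesEquiv (R := 𝓞 ℚ)).symm ⟨ℓ', hℓ'⟩ := by
  intro h'
  have h'' := congrArg (fun v ↦ (Rat.HeightOneSpectrum.primesEquiv (R := 𝓞 ℚ) v : ℕ)) h'
  simp only [Equiv.apply_symm_apply] at h''
  exact h h''

/-- The residue characteristic of the place of `ℓ` is `ℓ`. [folklore] -/
private theorem natGenerator_place' (ℓ : ℕ) (hℓ : ℓ.Prime) :
    Rat.HeightOneSpectrum.natGenerator ((Rat.HeightOneSpectrum.primesEquiv (R := 𝓞 ℚ)).symm ⟨ℓ, hℓ⟩) = ℓ :=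
  congrArg Subtype.val (Equiv.apply_symm_apply (Rat.HeightOneSpectrum.primesEquiv (R := 𝓞 ℚ)) _)

/-- `3 ∉ v` for the place of a prime `ℓ ≠ 3`. [folklore] -/
private theorem three_not_mem_place' {ℓ : ℕ} (hℓ : ℓ.Prime) (h3 : ℓ ≠ 3) :
    ((3 : ℕ) : 𝓞 ℚ) ∉ ((Rat.HeightOneSpectrum.primesEquiv (R := 𝓞 ℚ)).symm ⟨ℓ, hℓ⟩).asIdeal := by
  intro hmem
  have h := Rat.HeightOneSpectrum.primesEquiv_eq_of_natCast_mem
    ((Rat.HeightOneSpectrum.primesEquiv (R := 𝓞 ℚ)).symm ⟨ℓ, hℓ⟩) Nat.prime_three hmem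
  rw [Equiv.apply_symm_apply] at h
  exact h3 (by simpa using h)

/-- **`(5568g1, 3)` is ON THE CLOSED SUB-ROW, in the kernel, UNCONDITIONALLY**: the skeleton's sub-row existential at
`W = 5568g1 = [0, −1, 0, −493089, 628457121]` (the third conjunct of the case split in v5/v6's `upperPartner_all`; the `hbal`
of `upperPartner_at_three_of_balanceOne_of_{thmE,padicGZ}`). Witness: the rational `3`-line through the `Ψ₃`-root `33`
(kernel discriminant `2`: `2·34992² = Ψ₂Sq(33)`), `φ = χ̄₈` (mod `8`), the abstract quotient character, `S₀ = {(2), (29)}`;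
per-pair clauses from part 6 (additive at `2`, split multiplicative at `29`, good off `S₀ ∪ {3}`), balance `1 = s_29 + 0`.
No instrument reading, no named fact. [cite: GreenbergVatsal2000, §2 Prop. (2.4), p. 28 and §3 p. 43]
[cite: SilvermanAEC2009, VII.5 Prop. 5.1] -/
theorem subrowDatum_5568g1
    [(⟨0, -1, 0, -493089, 628457121⟩ : WeierstrassCurve ℚ).IsElliptic]
    [(⟨0, -1, 0, -493089, 628457121⟩ : WeierstrassCurve ℚ).IsGloballyMinimal] [Fact (Nat.Prime 3)] :
    ∃ (Φ₀ : AddSubgroup (geomTorsion (⟨0, -1, 0, -493089, 628457121⟩ : WeierstrassCurve ℚ) (3 : ℤ))) (m : ℕ)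
        (_ : NeZero m) (φ : DirichletCharacter (ZMod 3) m) (d : ℕ) (_ : NeZero d) (ψ : DirichletCharacter (ZMod 3) d)
        (S₀ : Finset (HeightOneSpectrum (𝓞 ℚ))),
      IsRationalLine (⟨0, -1, 0, -493089, 628457121⟩ : WeierstrassCurve ℚ) 3 Φ₀ ∧ φ.IsPrimitive ∧ ψ.IsPrimitive ∧
      (∀ (σ : absoluteGaloisGroup ℚ), ∀ P ∈ Φ₀,
        σ • P = (φ ((modNCyclotomicCharacter ℚ m σ : (ZMod m)ˣ) : ZMod m)).val • P) ∧
      (∀ (σ : absoluteGaloisGroup ℚ) (P : geomTorsion (⟨0, -1, 0, -493089, 628457121⟩ : WeierstrassCurve ℚ) (3 : ℤ)),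
        σ • P - (ψ ((modNCyclotomicCharacter ℚ d σ : (ZMod d)ˣ) : ZMod d)).val • P ∈ Φ₀) ∧
      (∀ v ∈ S₀, ((3 : ℕ) : 𝓞 ℚ) ∉ v.asIdeal) ∧
      (∀ v : HeightOneSpectrum (𝓞 ℚ), v ∉ S₀ → ((3 : ℕ) : 𝓞 ℚ) ∉ v.asIdeal →
        (⟨0, -1, 0, -493089, 628457121⟩ : WeierstrassCurve ℚ).HasGoodReductionAt v) ∧
      1 + ∑ v ∈ S₀, delta (⟨0, -1, 0, -493089, 628457121⟩ : WeierstrassCurve ℚ) 3 v =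
        ∑ v ∈ S₀, ((if φ (Rat.HeightOneSpectrum.natGenerator v : ZMod m) =
              (Rat.HeightOneSpectrum.natGenerator v : ZMod 3)
            then sFactor 3 (Rat.HeightOneSpectrum.natGenerator v) else 0) +
          (if ψ (Rat.HeightOneSpectrum.natGenerator v : ZMod d) =
              (Rat.HeightOneSpectrum.natGenerator v : ZMod 3)
            then sFactor 3 (Rat.HeightOneSpectrum.natGenerator v) else 0)) := by
  -- the rational `3`-line through `x₀ = 33` and its kernel discriminant `2`
  obtain ⟨Φ₀, hΦ, hker⟩ := KernelDisc.exists_isRationalLine_kernelChar_of_cert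
    (W := (⟨0, -1, 0, -493089, 628457121⟩ : WeierstrassCurve ℚ)) (x₀ := 33) (s := 34992) (D := 2)
    eval_Ψ₃_5568g1 (by norm_num) (by norm_num) EisensteinPrimesMazurMCOnCellBTwistbackSubrowCell5568g1.kernelDisc_cert_5568g1
  -- the places
  set v₂ : HeightOneSpectrum (𝓞 ℚ) := (Rat.HeightOneSpectrum.primesEquiv (R := 𝓞 ℚ)).symm ⟨2, Nat.prime_two⟩
    with hv₂
  set v₂₉ : HeightOneSpectrum (𝓞 ℚ) := (Rat.HeightOneSpectrum.primesEquiv (R := 𝓞 ℚ)).symm ⟨29, by norm_num⟩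
    with hv₂₉
  have hne : v₂ ≠ v₂₉ := place_ne' Nat.prime_two (by norm_num) (by norm_num)
  have hgen₂ : Rat.HeightOneSpectrum.natGenerator v₂ = 2 := natGenerator_place' 2 Nat.prime_two
  have hgen₂₉ : Rat.HeightOneSpectrum.natGenerator v₂₉ = 29 := natGenerator_place' 29 (by norm_num)
  have hsdiff : ({v₂, v₂₉} : Finset (HeightOneSpectrum (𝓞 ℚ))) \ {v₂} = {v₂₉} := by
    ext w
    simp only [Finset.mem_sdiff, Finset.mem_insert, Finset.mem_singleton]
    constructor
    · rintro ⟨h | h, h'⟩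
      · exact absurd h h'
      · exact h
    · intro h
      exact ⟨Or.inr h, fun h' ↦ hne (h'.symm.trans h)⟩
  refine exists_subrowDatum_of_kernelDisc_two_mul hΦ (n := 1) odd_one squarefree_one ?_ {v₂, v₂₉} ?_ ?_ {v₂}
    (Finset.singleton_subset_iff.mpr (Finset.mem_insert_self _ _)) ?_ ?_ ?_
  · have h2 : ((2 * ((-1 : ℤ) ^ ((1 : ℕ) / 2) * ((1 : ℕ) : ℤ)) : ℤ) : ℚ) = ((2 : ℤ) : ℚ) := by norm_num
    rw [h2]
    exact hker
  · intro v hv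
    rcases Finset.mem_insert.mp hv with h | h
    · rw [h]; exact three_not_mem_place' Nat.prime_two (by norm_num)
    · rw [Finset.mem_singleton.mp h]; exact three_not_mem_place' (by norm_num) (by norm_num)
  · intro v hv h3
    exact (good_outside_S₀ v hv h3).1
  · intro v hv
    rw [Finset.mem_singleton.mp hv]
    exact EisensteinPrimesMazurMCOnCellBTwistbackSubrowCell5568g1.additive_5568g1_at_two
  · intro v hv hvA
    rcases Finset.mem_insert.mp hv with h | h
    · exact absurd (Finset.mem_singleton.mpr h) hvA
    · rw [Finset.mem_singleton.mp h]
      exact EisensteinPrimesMazurMCOnCellBTwistbackSubrowCell5568g1.mult_split_5568g1_at_29.1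
  · rw [hsdiff, Finset.sum_singleton, Finset.sum_singleton,
      if_pos EisensteinPrimesMazurMCOnCellBTwistbackSubrowCell5568g1.mult_split_5568g1_at_29.2, hgen₂, hgen₂₉,
      if_pos (by norm_num : (2 : ℕ) ∣ 8 * 1)]
    have hs29 : sFactor 3 29 = 1 :=
      (EisensteinPrimesMazurMCOnCellBTwistbackSubrowEvaluatedBalance.sFactor_three_eq_one_iff (by norm_num)).mpr
        (by decide)
    rw [hs29]

end Summit.BirchSwinnertonDyer.BirchSwinnertonDyer.Theorems.EisensteinPrimesMazurMCOnCellBTwistbackSubrowDatumOfKernelDisc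

end
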